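import Summits.SmoothPoincare4.SmoothPoincare4.Theses.EntropyRung
import Summits.SmoothPoincare4.SmoothPoincare4.Theorems.EntropyRungNoncompactShrinkerGapReductionTextbook

/-!
# Route EntropyRung — `NoncompactGapReduction` (item stmt-SmoothPoincare4-16591)

Settles the glue item
`ThreeShrinkerGap → ShrinkerSplittingAtInfinity → BakryEmeryLogSobolev → ConicalGap → UnboundedCurvatureGap →
NoncompactShrinkerGap` of route EntropyRung: the whole reduction of the crux `NoncompactShrinkerGap` of line
`collapsed-ends-usc`, written over the route's own items.

Proof (pure logic over landed files): trichotomy on the scalar curvature `R` at infinity of the complete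
non-compact non-flat normalised 4-d shrinker `(M, g, f)`.
* `R` unbounded — the residue `UnboundedCurvatureGap`;
* `R` bounded and decaying to `0` at infinity — the residue `ConicalGap`;
* `R` bounded and non-decaying — the Bernstein–Wang lever
  `NoncompactShrinkerGapReductionTextbook.collapsedDirectionReduction_of_textbook` (landed, p116509): from
  `ShrinkerSplittingAtInfinity` (verbatim the Literature fact `shrinkerSplittingAtInfinity_four`) and the textbook
  Bakry–Émery LSI (the route item `BakryEmeryLogSobolev`, which is the Literature fact
  `bakryEmery_logSobolev_complete` with `g.riemVolume` / `g.riemEDist` unfolded one step — bridged here by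
  `riemVolume_eq` / `riemEDist_eq`) one gets a complete non-flat normalised 3-d shrinker `(N, h, φ)` with
  `∫_M e^{-f} ≤ 2√π ∫_N e^{-φ}`; `ThreeShrinkerGap` caps `∫_N e^{-φ} ≤ 16π² e^{-3/2}` and
  `2√π · 16π² e^{-3/2} = 32π²√π e^{-3/2}` (`lineFactor_mul_threeBound`).

No definition and no named fact is introduced; every hypothesis is a route item.
-/

noncomputable section

-- the registered namespace `Summit.SmoothPoincare4.SmoothPoincare4.Theorems` repeats a component
set_option linter.dupNamespace false

open scoped Manifold ContDiff ENNReal NNReal Topology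
open MeasureTheory Set Filter
open Literature.Geometry.Lorentzian Literature.Geometry.Riemannian

namespace Summit.SmoothPoincare4.SmoothPoincare4.Theorems

open Summit.SmoothPoincare4.SmoothPoincare4.Theses.EntropyRung
open Summit.SmoothPoincare4.SmoothPoincare4.Theorems.NoncompactShrinkerGapReduction
open Summit.SmoothPoincare4.SmoothPoincare4.Theorems.NoncompactShrinkerGapReductionTextbook

/-- **Bridge**: the route item `BakryEmeryLogSobolev` (completeness via `g.edist hg`, integrals against
`riemannianMeasure (g.toContMDiffRiemannianMetric hg)`) gives the Literature named fact
`bakryEmery_logSobolev_complete` (the same text over `g.riemEDist` / `g.riemVolume`), by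
`riemEDist_eq hg` / `riemVolume_eq hg`. [cite: CarrilloNi2009, Thm. 3.1 (p. 7)] -/
theorem bakryEmery_logSobolev_complete_of_item (hBE : BakryEmeryLogSobolev) :
    bakryEmery_logSobolev_complete := by
  intro n M _ _ _ _ _ _ _ _ _ g _ V K hg hc hV hK hCD hnormV φ hφ hφ1 hP2 hFisher
  have hc' : ∀ (x : M) (r : NNReal), IsCompact {y : M | g.edist hg x y ≤ r} := by
    simpa only [PseudoRiemannianMetric.riemEDist_eq hg] using hc
  simp only [PseudoRiemannianMetric.riemEDist_eq hg, PseudoRiemannianMetric.riemVolume_eq hg]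
    at hnormV hφ1 hP2 hFisher ⊢
  exact hBE n M g V K hg hc' hV hK hCD hnormV φ hφ hφ1 hP2 hFisher

/-- **Bridge**: the route item `ShrinkerSplittingAtInfinity` is verbatim the Literature named fact
`shrinkerSplittingAtInfinity_four`. [cite: MunteanuWang2015, Thm. 1 (p. 2)] -/
theorem shrinkerSplittingAtInfinity_four_of_item (hsplit : ShrinkerSplittingAtInfinity) :
    shrinkerSplittingAtInfinity_four :=
  hsplit

/-- **The crux on the bounded-curvature non-conical class, over the route items**: for a complete connected
non-compact non-flat normalised 4-d shrinker whose scalar curvature is bounded and does not decay at infinity,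
`∫ e^{-f} dV ≤ 32π²√π e^{-3/2}` — the lever `collapsedDirectionReduction_of_textbook` (from
`ShrinkerSplittingAtInfinity` and `BakryEmeryLogSobolev`) composed with the 3-d rung `ThreeShrinkerGap` and the
arithmetic `2√π · 16π² e^{-3/2} = 32π²√π e^{-3/2}`. [cite: BernsteinWang2016, Thm 1.2, Cor 6.6] -/
theorem nonDecayingGap_of_items (hT : ThreeShrinkerGap) (hsplit : ShrinkerSplittingAtInfinity)
    (hBE : BakryEmeryLogSobolev)
    (M : Type) [TopologicalSpace M] [T2Space M] [SecondCountableTopology M]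
    [ChartedSpace (EuclideanSpace ℝ (Fin 4)) M] [IsManifold (𝓡 4) ∞ M] [ConnectedSpace M] [NoncompactSpace M]
    [T3Space M] [MeasurableSpace M] [BorelSpace M]
    (g : PseudoRiemannianMetric (𝓡 4) ∞ (EuclideanSpace ℝ (Fin 4)) (TangentSpace (𝓡 4) : M → Type _))
    [g.HasLeviCivita] (f : M → ℝ) (hg : g.IsRiemannian)
    (hc : ∀ (x : M) (r : NNReal), IsCompact {y : M | g.edist hg x y ≤ r})
    (hf : ContMDiff (𝓡 4) 𝓘(ℝ, ℝ) ∞ f)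
    (hsol : ∀ (x : M) (X Y : TangentSpace (𝓡 4) x),
      g.ricci x X Y + g.hessian f x X Y = (1 / 2 : ℝ) * g.val x X Y)
    (hnorm : ∀ x : M, g.scalarCurvature x + g.gradSq f x = f x)
    (hnf : ∃ x : M, g.scalarCurvature x ≠ 0)
    (hbdd : ∃ C : ℝ, ∀ x : M, g.scalarCurvature x ≤ C)
    (hnd : ∃ ε : ℝ, 0 < ε ∧ ∀ K : Set M, IsCompact K → ∃ x, x ∉ K ∧ ε ≤ g.scalarCurvature x) :
    ∫⁻ x, ENNReal.ofReal (Real.exp (-f x)) ∂(riemannianMeasure (g.toContMDiffRiemannianMetric hg)) ≤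
      ENNReal.ofReal (32 * Real.pi ^ 2 * Real.sqrt Real.pi * Real.exp (-(3 : ℝ) / 2)) := by
  obtain ⟨N, _, _, _, _, _, _, _, _, _, h, _, φ, hh, hcN, hφ, hsolN, hnormN, hnfN, hZ⟩ :=
    collapsedDirectionReduction_of_textbook (shrinkerSplittingAtInfinity_four_of_item hsplit)
      (bakryEmery_logSobolev_complete_of_item hBE) M g f hg hc hf hsol hnorm hnf hbdd hnd
  have h3 : ∫⁻ x, ENNReal.ofReal (Real.exp (-φ x)) ∂(riemannianMeasure (h.toContMDiffRiemannianMetric hh))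
      ≤ ENNReal.ofReal (16 * Real.pi ^ 2 * Real.exp (-(3 : ℝ) / 2)) :=
    hT N h φ hh hcN hφ hsolN hnormN hnfN
  calc ∫⁻ x, ENNReal.ofReal (Real.exp (-f x)) ∂(riemannianMeasure (g.toContMDiffRiemannianMetric hg))
      ≤ ENNReal.ofReal (2 * Real.sqrt Real.pi) * ∫⁻ x, ENNReal.ofReal (Real.exp (-φ x))
          ∂(riemannianMeasure (h.toContMDiffRiemannianMetric hh)) := hZ
    _ ≤ ENNReal.ofReal (2 * Real.sqrt Real.pi) * ENNReal.ofReal (16 * Real.pi ^ 2 * Real.exp (-(3 : ℝ) / 2)) := by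
        gcongr
    _ = ENNReal.ofReal (32 * Real.pi ^ 2 * Real.sqrt Real.pi * Real.exp (-(3 : ℝ) / 2)) :=
        lineFactor_mul_threeBound

/-- Settles stmt-SmoothPoincare4-16591 (`EntropyRung.NoncompactGapReduction`):
`ThreeShrinkerGap → ShrinkerSplittingAtInfinity → BakryEmeryLogSobolev → ConicalGap → UnboundedCurvatureGap →
NoncompactShrinkerGap`. Proof: trichotomy on the scalar curvature at infinity — unbounded `R` is the residue
`UnboundedCurvatureGap`, bounded `R` decaying to `0` the residue `ConicalGap`, bounded non-decaying `R` is
`nonDecayingGap_of_items` (lever + 3-d rung). [cite: BernsteinWang2016, Thm 1.2]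
[cite: MunteanuWang2019, proof of Thm 5.1 (p. 21)] -/
theorem noncompactGapReduction_proof :
    Summit.SmoothPoincare4.SmoothPoincare4.Theses.EntropyRung.NoncompactGapReduction := by
  unfold Summit.SmoothPoincare4.SmoothPoincare4.Theses.EntropyRung.NoncompactGapReduction
  intro hT hsplit hBE hC hD M _ _ _ _ _ _ _ _ _ _ g _ f hg hc hf hsol hnorm hnf
  by_cases hbdd : ∃ C : ℝ, ∀ x : M, g.scalarCurvature x ≤ C
  · by_cases hflat : ∀ ε : ℝ, 0 < ε → ∃ K : Set M, IsCompact K ∧ ∀ x, x ∉ K → g.scalarCurvature x < ε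
    · exact hC M g f hg hc hf hsol hnorm hnf hflat
    · exact nonDecayingGap_of_items hT hsplit hBE M g f hg hc hf hsol hnorm hnf hbdd
        (exists_nondecaying_of_not_flatAtInfinity hflat)
  · exact hD M g f hg hc hf hsol hnorm hnf hbdd

end Summit.SmoothPoincare4.SmoothPoincare4.Theorems

end
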